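import Summits.QuantumFields.YangMills.Theorems.BalabanUVNodesN06Eq3132DecayFromMajorantKnitQ

/-!
# BalabanUVNodes ∕ N06 ([B9], `Dag.B9_main`) — R1 J-TWIN: THE `DecayUnder` INPUT OF THE ROW-26 COMBES–THOMAS FACE FOR THE Λ-NORMALISED `Q(U) T(U) Q⋆(U)` AT PRINT's
# KNIT AVERAGING, ALONG A SUB-FAMILY `f : J → MemberY …` — the J-twin of ✓`…N06Eq3132DecayFromMajorantKnitQ.decayUnder_QGQOfQY_knit_of_majorants_R` (dag-n06-l g37,
# P-Q26-knit piece 2)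

Track A of `YM-PLAN.md` (cell `pub-ymgap`, HUMAN RULING D-0062), node **N06** = [Balaban1985BackgroundPropagators]; IR-N06-SECTION-2 road **R1** («J-twin of the
producer cone», ★★★ director-ym №524 (3): authorised in principle, STAGED, sibling files only, one file on a by-name ask), dag-n06-d's `R1-JTWIN-SPEC.md` rule (R)′
(2026-08-31): re-key EXACTLY the section-tainted ∀-member rows along `f`, keep data ∕ pins ∕ laws ∕ section-free rows member-wide, conclusions along `f`.
Seat `pub-ymgap-dag-n06-l` g41 (R1 ORDER: a leaf — no family-wide callee; consumers to come: `…N06D2SupPrechainV2AtPinsPUWQ`ᴶ, `…N06Eq3132FromStateKnitQ`ᴶ).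

WHAT.  `decayUnder_QGQOfQY_knit_of_majorants_R_J` = the parent's theorem with `{J : Type} (f : J → MemberY d ℓ hd hL b₀ b₁ Mstar)` added after the instance binders and
* TAINTED ROW OF THIS TWIN: `h` — the family of block majorants of `T(U)` (`∃ M₂ a₂ C δ, … ∀ member …`; in the knit prechain it is the `G̃[𝔮]`-letter family ⟸ P-D2-knit (7)
  ⟸ the state layer ⟸ (3.49) `h49` ⟸ (3.48) `h348`), re-keyed `∀ x : MemberY … ↦ ∀ j : J`, read at `f j`;
* LEFT member-wide: the letter families `T 𝔮 𝔮⋆`, the pins `h𝔮 h𝔮s`, the regime bridge `hRP`, the block-map laws `hlev hβ1`, the neighbour count `hnbr`, the x-free knit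
  numerics `hc hα' hαQ haK hKpl`, the implicit weight∕exponent families `R H`;
* conclusion `DecayUnder c35 (fun j => geoComap (geo9Y (f j)) Prod.fst) (fun j => bg9YR … R₁ R₂ (f j)) (fun j U => normMatY b Λ⁻¹ (QGQOfQY (f j).toKIdx (𝔮 (f j)) (𝔮⋆ (f j)) (T (f j)) U))`
  — the index-generic `B9Eq3132CTInputs.DecayUnder` at `I := J` (rule (R)′.3).
The per-member entry bound `abs_normMatY_QGQOfQY_le_of_hasMajorant_knit` (parent §Entry, `i : KIdx`) is NOT restated — it is per member already.
PROOF: the parent's text by generator (`mkJ.py` over the tree bytes): `fun x ↦ fun j`, member reads `x ↦ f j`, `hmaj x ↦ hmaj j`; nothing re-derived.  The member-wide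
parent is the instance `J := MemberY …`, `f := id`.  ORPHAN by design until its consumers' twins land (honest).
HONEST FRAMING.  Bookkeeping over landed objects; the block majorants of `T(U)` are a HYPOTHESIS; nothing of [B9] ∕ [4] asserted; COUNT-NEUTRAL
(`--supports stmt-QuantumFields-27239 --as helper`); N06 NOT discharged; K1 NOT closed; under R1 the inner-corner question stays DISPLAYED at the K1 face ∕ NODE O join
by (α5); nothing continuum ∕ OS ∕ mass gap ∕ Clay.  0 `def`, 0 `sorry`.  NEW file; the parent untouched.
[cite: Balaban1985BackgroundPropagators, (3.132) p.422, Thm 3.12 p.423 (prefix), (3.115) p.418, (3.35)–(3.36) p.396; Balaban1984PropagatorsII, (2.142) p.248,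
(2.149) p.249, Lemma 2.1 (2.60) p.234; Balaban1985Averaging, (139)–(147) pp.39–40]
-/

noncomputable section

namespace Summit.QuantumFields.YangMills.BalabanUVNodes.N06Eq3132DecayFromMajorantKnitQJ

open scoped Matrix.Norms.L2Operator
open Literature.MathematicalPhysics.QuantumFieldTheory.Balaban1983to89
open Literature.MathematicalPhysics.QuantumFieldTheory.Balaban1983to89.Node00
open Literature.MathematicalPhysics.QuantumFieldTheory.Balaban1983to89.B6RandomWalk (HasMajorant)
open Literature.MathematicalPhysics.QuantumFieldTheory.Balaban1983to89.B9CoReadingCoords (XBK blkBK GcoK)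
open Literature.MathematicalPhysics.QuantumFieldTheory.Balaban1983to89.B9Thm39ReadingCoords (basisBound39)
open Literature.MathematicalPhysics.QuantumFieldTheory.Balaban1983to89.B6Ineq2142KLevelV1 (lvl β)
open Literature.MathematicalPhysics.QuantumFieldTheory.Balaban1983to89.B9Eq3132Ineq2142Covariant (abs_normMatY_le levelFactor_le)
open Literature.MathematicalPhysics.QuantumFieldTheory.Balaban1983to89.B9Eq3132DecayFromMajorant (norm_basis_le)
open Literature.MathematicalPhysics.QuantumFieldTheory.Balaban1983to89.B6KLevelCensusIndexV1 (KIdx kGeo)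
open Literature.MathematicalPhysics.QuantumFieldTheory.Balaban1983to89.B6GlobalChartV1 (blkV1)
open Literature.MathematicalPhysics.QuantumFieldTheory.Balaban1983to89.B9Thm34Ext (toB6)
open Literature.MathematicalPhysics.QuantumFieldTheory.Balaban1983to89.B9PinMembersKLevelV1 (MemberY geo9Y bg9Y)
open Literature.MathematicalPhysics.QuantumFieldTheory.Balaban1983to89.B9BackgroundsKLevelV1R (RegFamY bg9YR)
open Literature.MathematicalPhysics.QuantumFieldTheory.Balaban1983to89.B9GeoLemma21KLevelV1 (geo9K_len_pos)
open Literature.MathematicalPhysics.QuantumFieldTheory.Balaban1983to89.B9GeoNormsKLevelV1 (geo9K)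
open Literature.MathematicalPhysics.QuantumFieldTheory.Balaban1983to89.B9RWSumsReadsNbr (nbr)
open Literature.MathematicalPhysics.QuantumFieldTheory.Balaban1983to89.B9Eq3132RingInverseReading (normMatY dimConstY' dimConstY'_pos)
open Literature.MathematicalPhysics.QuantumFieldTheory.Balaban1983to89.B9Eq3132NuReading (lamInvY lamInvY_pos)
open Literature.MathematicalPhysics.QuantumFieldTheory.Balaban1983to89.B9Eq3132CTInputs (DecayUnder)
open Literature.MathematicalPhysics.QuantumFieldTheory.Balaban1983to89.B9Eq3132ScalarIndex (geoComap)
open Literature.MathematicalPhysics.QuantumFieldTheory.Balaban1983to89.Node00.OpsYQLetter (QLetterY QsLetterY adjTrY)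
open Literature.MathematicalPhysics.QuantumFieldTheory.Balaban1983to89.B9Eq316AveragingTransposeZd (alphaQ)
open Literature.MathematicalPhysics.QuantumFieldTheory.Balaban1983to89.B9Eq3115KnitLetterY (QknitY)
open Literature.MathematicalPhysics.QuantumFieldTheory.Balaban1983to89.B9Eq3115KnitLetterYOnto (kCol kCol_nonneg)
open Literature.MathematicalPhysics.QuantumFieldTheory.Balaban1983to89.B9C2FormBoxRegimeY (Kpl)
open Literature.MathematicalPhysics.QuantumFieldTheory.Balaban1983to89.B9BackgroundsKLevelV1P (bg9KP)
open Literature.MathematicalPhysics.QuantumFieldTheory.Balaban1983to89.B7Prop2Explicit (unitaryUnits)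
open Summit.QuantumFields.YangMills.BalabanUVNodes.N06Eq3132Ineq2142KnitQ (norm_QGQOfQY_deltaY_le_knit)
open Summit.QuantumFields.YangMills.BalabanUVNodes.N06Eq3132DecayFromMajorantKnitQ (abs_normMatY_QGQOfQY_le_of_hasMajorant_knit)

variable {N : ℕ} [Nonempty (Fin N)]
variable {κ : Type} [Fintype κ] [DecidableEq κ] {Ff : Type} [Fintype Ff] [DecidableEq Ff]
variable {d ℓ : ℕ} {hd : 1 ≤ d + 1} {hL : Odd (ℓ + 1) ∧ 1 < ℓ + 1} {b₀ b₁ : ℝ} {Mstar : ℕ}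
variable {G : Subgroup (Matrix (Fin N) (Fin N) ℂ)ˣ}
variable (R₁ R₂ : RegFamY d ℓ hd hL b₀ b₁ Mstar (Matrix (Fin N) (Fin N) ℂ))

/-- ★★ **`DecayUnder` FOR THE Λ-NORMALISED `Q(U) T(U) Q⋆(U)` AT THE KNIT PAIR FROM A FAMILY OF BLOCK MAJORANTS, OVER `bg9YR … G R₁ R₂`** (the knit twin of dag-n06-i's
`decayUnder_QGQOfY_of_majorants_R`, same proof text): letter families `𝔮, 𝔮⋆` pinned to `QknitY ∕ adjTrY (QknitY ·)`; `G ≤ U(N)`; the regime bridge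
`hRP : (bg9YR … x).Reg335 c35 α₀ U → (bg9KP … G x.toKIdx).Reg335 c₀ α₀ U` (`c₀ ≤ 10`); x-free numerics `0 < α₀′ ≤ α_Q`, `hKpl`; `bI` level-∕1-faithful, count `mN`; the family of [4]-(2.51)
majorants `C(Lʲη)²e^{−δd}` of `GcoK … (T x) U` above `M₂` and below `Mα₀ ≤ a₂`.  THEN the real matrix `diag(Λ⁻¹∕κ′)·reMatY(Q T(U) Q⋆)·diag(Λ⁻¹)` decays like `B·e^{−(δ∕2)d}` above
`max(M₂, (d+3)log L ∕ (δ(2L²−1)))` and below `min(a₂, aK)`. [cite: Balaban1985BackgroundPropagators, (3.132) p.422, Thm 3.12 p.423, (3.115) p.418, (3.35) p.396; Balaban1984PropagatorsII, (2.142) p.248, (2.149) p.249, (2.60) p.234] -/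
theorem decayUnder_QGQOfQY_knit_of_majorants_R_J (hGU : G ≤ unitaryUnits (Matrix (Fin N) (Fin N) ℂ))
    [∀ x : MemberY d ℓ hd hL b₀ b₁ Mstar, Fintype (geo9Y x).Site]
    [∀ x : MemberY d ℓ hd hL b₀ b₁ Mstar, DecidableEq (geo9Y x).Site] {J : Type} (f : J → MemberY d ℓ hd hL b₀ b₁ Mstar) (bK : Module.Basis κ ℝ (Matrix (Fin N) (Fin N) ℂ)) (b : Module.Basis Ff ℝ (Matrix (Fin N) (Fin N) ℂ))
    {c35 : ℝ} (T : ∀ x : MemberY d ℓ hd hL b₀ b₁ Mstar, BondOpY (Matrix (Fin N) (Fin N) ℂ) x.toKIdx)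
    (𝔮 : ∀ x : MemberY d ℓ hd hL b₀ b₁ Mstar, QLetterY (Matrix (Fin N) (Fin N) ℂ) x.toKIdx)
    (𝔮s : ∀ x : MemberY d ℓ hd hL b₀ b₁ Mstar, QsLetterY (Matrix (Fin N) (Fin N) ℂ) x.toKIdx)
    (h𝔮 : ∀ (x : MemberY d ℓ hd hL b₀ b₁ Mstar) (U : CfgY (Matrix (Fin N) (Fin N) ℂ) x.toKIdx), 𝔮 x U = QknitY x.toKIdx U)
    (h𝔮s : ∀ (x : MemberY d ℓ hd hL b₀ b₁ Mstar) (U : CfgY (Matrix (Fin N) (Fin N) ℂ) x.toKIdx), 𝔮s x U = adjTrY (QknitY x.toKIdx U))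
    {c₀ : ℝ} (hc : c₀ ≤ 10)
    (hRP : ∀ (x : MemberY d ℓ hd hL b₀ b₁ Mstar) (α₀ : ℝ) (U : (bg9YR (Matrix (Fin N) (Fin N) ℂ) G R₁ R₂ x).Cfg),
      (bg9YR (Matrix (Fin N) (Fin N) ℂ) G R₁ R₂ x).Reg335 c35 α₀ U → (bg9KP (Matrix (Fin N) (Fin N) ℂ) G x.toKIdx).Reg335 c₀ α₀ U)
    {α₀' : ℝ} (hα' : 0 < α₀') (hαQ : α₀' ≤ alphaQ (d + 1) (ℓ + 1)) {aK : ℝ} (haK : 0 < aK)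
    (hKpl : ∀ (x : MemberY d ℓ hd hL b₀ b₁ Mstar) (a : ℝ), 0 ≤ a → a ≤ aK → Kpl x.toKIdx a * (kGeo x.toKIdx).L ^ 4 < α₀')
    {bI : ∀ x : MemberY d ℓ hd hL b₀ b₁ Mstar, FBondY x.toKIdx → IBondY x.toKIdx}
    (hlev : ∀ (x : MemberY d ℓ hd hL b₀ b₁ Mstar) (f : FBondY x.toKIdx), lvl x.hN x.D x.hk (bI x f) = (blkV1 x.hN x.D f).1.1)
    (hβ1 : ∀ (x : MemberY d ℓ hd hL b₀ b₁ Mstar) (f : FBondY x.toKIdx), (B6Geom246MultiLevelTorus.geomT x.D).dist (β x.hN x.D x.hk (bI x f)) (blkV1 x.hN x.D f) ≤ 1)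
    {mN : ℕ} (hnbr : ∀ (x : MemberY d ℓ hd hL b₀ b₁ Mstar) (y : (geo9Y x).Site), (nbr (geo9Y x) ((ℓ : ℝ) + 4) y).card ≤ mN)
    {R : MemberY d ℓ hd hL b₀ b₁ Mstar → ℝ} {H : MemberY d ℓ hd hL b₀ b₁ Mstar → Prop}
    (h : ∃ M₂ a₂ C δ : ℝ, 0 < M₂ ∧ 0 < a₂ ∧ 0 ≤ C ∧ 0 < δ ∧
      ∀ j : J, M₂ ≤ (geo9Y (f j)).M → ∀ α₀ : ℝ, 0 < α₀ → (geo9Y (f j)).M * α₀ ≤ a₂ →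
        ∀ U : (bg9YR (Matrix (Fin N) (Fin N) ℂ) G R₁ R₂ (f j)).Cfg,
          (bg9YR (Matrix (Fin N) (Fin N) ℂ) G R₁ R₂ (f j)).Reg335 c35 α₀ U → (bg9YR (Matrix (Fin N) (Fin N) ℂ) G R₁ R₂ (f j)).Reg336 c35 α₀ U →
          HasMajorant (g := toB6 (geo9Y (f j)) (R (f j)) (H (f j))) (blkBK (f j).toKIdx (bI (f j))) (GcoK (f j).toKIdx bK (bg9YR (Matrix (Fin N) (Fin N) ℂ) G R₁ R₂ (f j)) (fun U => U) (T (f j)) U)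
            (fun a a' => C * (geo9Y (f j)).len a ^ 2 * Real.exp (-(δ * (geo9Y (f j)).dist a a')))) :
    DecayUnder c35 (fun j : J => geoComap (geo9Y (f j)) (Prod.fst : (geo9Y (f j)).Site × Ff → (geo9Y (f j)).Site))
      (fun j : J => bg9YR (Matrix (Fin N) (Fin N) ℂ) G R₁ R₂ (f j)) (fun j U => normMatY b (lamInvY (f j).toKIdx) (QGQOfQY (f j).toKIdx (𝔮 (f j)) (𝔮s (f j)) (T (f j)) U)) := by
  obtain ⟨M₂, a₂, C, δ, hM₂, ha₂, hC, hδ, hmaj⟩ := h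
  -- the knit constant in front of `C`
  set CK : ℝ := (1 + kCol (d + 1) (ℓ + 1) * α₀' * (2 * ((d : ℝ) + 1))) * (N : ℝ) ^ 4 * (1 + kCol (d + 1) (ℓ + 1) * α₀') * C with hCK
  have hkc : 0 ≤ kCol (d + 1) (ℓ + 1) * α₀' := mul_nonneg (kCol_nonneg _ _) hα'.le
  have hCK0 : 0 ≤ CK := by rw [hCK]; positivity
  -- the constants: the (2.60) threshold, the prefactor
  set L : ℝ := ((ℓ + 1 : ℕ) : ℝ) with hLdef
  have hL1 : (1 : ℝ) ≤ L := by rw [hLdef]; exact_mod_cast Nat.succ_le_succ (Nat.zero_le ℓ)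
  set MT : ℝ := ((d : ℝ) + 3) * Real.log L / (δ * (2 * ((ℓ : ℝ) + 1) ^ 2 - 1)) with hMT
  have hden : 0 < δ * (2 * ((ℓ : ℝ) + 1) ^ 2 - 1) := mul_pos hδ (by nlinarith [(Nat.cast_nonneg ℓ : (0 : ℝ) ≤ ℓ)])
  set B : ℝ := basisBound39 b * (‖(b.equivFunL : Matrix (Fin N) (Fin N) ℂ →L[ℝ] (Ff → ℝ))‖ / dimConstY' b) * (mN * CK * Real.exp (2 * (δ * ((ℓ : ℝ) + 4)))) *
    L ^ (((d : ℝ) + 3) / 2) with hB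
  have hB0 : 0 ≤ B := by
    rw [hB]
    have : 0 ≤ basisBound39 b := Finset.sum_nonneg fun _ _ => norm_nonneg _
    have := dimConstY'_pos b
    positivity
  refine ⟨max M₂ MT, min a₂ aK, B, δ / 2, lt_of_lt_of_le hM₂ (le_max_left _ _), lt_min ha₂ haK, hB0, half_pos hδ, fun j hM α₀ hα₀ hMa U hU hU' a c => ?_⟩
  have hM2 : M₂ ≤ (geo9Y (f j)).M := (le_max_left _ _).trans hM
  have hMTx : MT ≤ (geo9Y (f j)).M := (le_max_right _ _).trans hM
  have hMa₂ : (geo9Y (f j)).M * α₀ ≤ a₂ := hMa.trans (min_le_left _ _)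
  have hMaK : (geo9Y (f j)).M * α₀ ≤ aK := hMa.trans (min_le_right _ _)
  have h0 := hmaj j hM2 α₀ hα₀ hMa₂ U hU hU'
  -- the knit regime at this member and configuration
  have hMx : 0 ≤ (geo9Y (f j)).M := hM₂.le.trans hM2
  have hMα : 0 ≤ (kGeo (f j).toKIdx).M * α₀ := mul_nonneg hMx hα₀.le
  have hKx : Kpl (f j).toKIdx ((kGeo (f j).toKIdx).M * α₀) * (kGeo (f j).toKIdx).L ^ 4 < α₀' := hKpl (f j) _ hMα hMaK
  -- (2.142) at `U` for the block entry on the basis direction `b c.2`, at the knit pair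
  have h2142 := norm_QGQOfQY_deltaY_le_knit (f j).toKIdx (instF := (inferInstance : Fintype (geo9Y (f j)).Site)) bK (B := bg9YR (Matrix (Fin N) (Fin N) ℂ) G R₁ R₂ (f j))
    (fun U => U) (T (f j)) (𝔮 (f j)) (𝔮s (f j)) U (h𝔮 (f j) U) (h𝔮s (f j) U) hGU hc hMα (hRP (f j) α₀ U hU) hα' hαQ hKx (hlev (f j)) (hβ1 (f j)) (hnbr (f j)) hC hδ.le h0 a.1 c.1 (b c.2)
  -- the normalised entry through the block entry
  have h4 := abs_normMatY_le (X := (geo9Y (f j)).Site) b (fun y => (lamInvY_pos (f j).toKIdx y).le) (QGQOfQY (f j).toKIdx (𝔮 (f j)) (𝔮s (f j)) (T (f j)) U) a c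
  -- the level factor under the (2.60) threshold
  have hlog : ((d : ℝ) + 3) * Real.log (geo9Y (f j)).L ≤ δ * (2 * ((ℓ : ℝ) + 1) ^ 2 - 1) * (geo9Y (f j)).M := by
    have h1 : ((d : ℝ) + 3) * Real.log L = MT * (δ * (2 * ((ℓ : ℝ) + 1) ^ 2 - 1)) := by
      rw [hMT, div_mul_cancel₀ _ hden.ne']
    have hLx : (geo9Y (f j)).L = L := rfl
    rw [hLx, h1, mul_comm]
    exact mul_le_mul_of_nonneg_left hMTx hden.le
  have h5 := levelFactor_le (f j).toKIdx hδ hlog a.1 c.1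
  -- assemble (all lengths and distances in the `geo9Y (f j)` spelling; plain real arithmetic on atoms)
  have hκ := dimConstY'_pos b
  have hrepr : 0 ≤ ‖(b.equivFunL : Matrix (Fin N) (Fin N) ℂ →L[ℝ] (Ff → ℝ))‖ / dimConstY' b :=
    div_nonneg (norm_nonneg (b.equivFunL : Matrix (Fin N) (Fin N) ℂ →L[ℝ] (Ff → ℝ))) hκ.le
  have hbb0 : 0 ≤ basisBound39 b := Finset.sum_nonneg fun _ _ => norm_nonneg _
  have hbf : ‖b c.2‖ ≤ basisBound39 b := norm_basis_le b c.2
  have hdist : (geoComap (geo9Y (f j)) (Prod.fst : (geo9Y (f j)).Site × Ff → (geo9Y (f j)).Site)).dist a c = (geo9Y (f j)).dist a.1 c.1 := rfl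
  rw [hdist]
  have h2142' : ‖QGQOfQY (f j).toKIdx (𝔮 (f j)) (𝔮s (f j)) (T (f j)) U (deltaY c.1 (b c.2)) a.1‖ ≤
      mN * CK * Real.exp (2 * (δ * ((ℓ : ℝ) + 4))) * (geo9Y (f j)).len a.1 ^ 2 * ((((ℓ + 1 : ℕ) : ℝ) ^ (d + 1)) ^ (lvl (f j).hN (f j).D (f j).hk c.1))⁻¹ *
        Real.exp (-(δ * (geo9Y (f j)).dist a.1 c.1)) * ‖b c.2‖ := by rw [hCK]; exact h2142
  have h5' : lamInvY (f j).toKIdx a.1 * lamInvY (f j).toKIdx c.1 * (geo9Y (f j)).len a.1 ^ 2 * ((((ℓ + 1 : ℕ) : ℝ) ^ (d + 1)) ^ (lvl (f j).hN (f j).D (f j).hk c.1))⁻¹ ≤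
      L ^ (((d : ℝ) + 3) / 2) * Real.exp (δ / 2 * (geo9Y (f j)).dist a.1 c.1) := h5
  -- chain the two estimates (the block entry is eliminated), then name the remaining atoms
  have s12 := h4.trans (mul_le_mul_of_nonneg_left h2142'
    (mul_nonneg (mul_nonneg (lamInvY_pos (f j).toKIdx a.1).le (lamInvY_pos (f j).toKIdx c.1).le) hrepr))
  generalize hΛa : lamInvY (f j).toKIdx a.1 = Λa at h5' s12
  generalize hΛc : lamInvY (f j).toKIdx c.1 = Λc at h5' s12
  generalize hla : (geo9Y (f j)).len a.1 = la at s12 h5'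
  generalize hpw : ((((ℓ + 1 : ℕ) : ℝ) ^ (d + 1)) ^ (lvl (f j).hN (f j).D (f j).hk c.1))⁻¹ = pw at s12 h5'
  generalize hD : (geo9Y (f j)).dist a.1 c.1 = D at s12 h5' ⊢
  generalize hr : ‖(b.equivFunL : Matrix (Fin N) (Fin N) ℂ →L[ℝ] (Ff → ℝ))‖ / dimConstY' b = r at s12 hrepr hB
  generalize hK : (mN : ℝ) * CK * Real.exp (2 * (δ * ((ℓ : ℝ) + 4))) = K at s12 hB
  generalize hnb : ‖b c.2‖ = nb at s12 hbf
  generalize hLB : L ^ (((d : ℝ) + 3) / 2) = LB at h5' hB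
  have hK0 : 0 ≤ K := by rw [← hK]; positivity
  have hΛa0 : 0 ≤ Λa := by rw [← hΛa]; exact (lamInvY_pos _ _).le
  have hΛc0 : 0 ≤ Λc := by rw [← hΛc]; exact (lamInvY_pos _ _).le
  have hpw0 : 0 ≤ pw := by rw [← hpw]; positivity
  have s3 : Λa * Λc * r * (K * la ^ 2 * pw * Real.exp (-(δ * D)) * nb) = r * K * nb * (Λa * Λc * la ^ 2 * pw) * Real.exp (-(δ * D)) := by ring
  have s4 : r * K * nb * (Λa * Λc * la ^ 2 * pw) * Real.exp (-(δ * D)) ≤ r * K * basisBound39 b * (LB * Real.exp (δ / 2 * D)) * Real.exp (-(δ * D)) := by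
    refine mul_le_mul_of_nonneg_right ?_ (Real.exp_nonneg _)
    exact mul_le_mul (mul_le_mul_of_nonneg_left hbf (mul_nonneg hrepr hK0)) h5'
      (mul_nonneg (mul_nonneg (mul_nonneg hΛa0 hΛc0) (sq_nonneg _)) hpw0) (mul_nonneg (mul_nonneg hrepr hK0) hbb0)
  have s5 : r * K * basisBound39 b * (LB * Real.exp (δ / 2 * D)) * Real.exp (-(δ * D)) = B * Real.exp (-(δ / 2 * D)) := by
    rw [hB, show Real.exp (-(δ / 2 * D)) = Real.exp (δ / 2 * D) * Real.exp (-(δ * D)) by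
      rw [← Real.exp_add]; congr 1; ring]
    ring
  exact s12.trans (s3.le.trans (s4.trans s5.le))

/-! ## §2 One member, one configuration: the normalised entry from a block majorant at the knit pair (the `CoerciveFromGA` transfer's input) -/

end Summit.QuantumFields.YangMills.BalabanUVNodes.N06Eq3132DecayFromMajorantKnitQJ

end
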